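import Mathlib

/-! # T5TraceDualConductor — «Tr(I) ⊆ O_F ⟺ I ⊆ 𝔇⁻¹»: the ideal-theoretic core of (A6)

Blind cell pub-hodge-repro2, seat p4 (Tier-5 kernel annex, README §7; record-class, cited by p-id
or ignored, never an input). README §8(d): uses an L-value-free non-vanishing device: NO.

The «ONE LINE» of route/T5-route-2.md l. 599 behind (A6) («n(ψ_F∘Tr_{E_v/F_v}) = e·n(ψ_F) +
d(E_v/F_v)», [P†] from Cassels–Fröhlich Ch. III §3 (3) / [C] FM21 Lemma 3.1): «ψ_F∘Tr is trivial on
P_E^{−m} ⟺ Tr(P_E^{−m}) ⊂ P_F^{−n(ψ_F)} ⟺ Tr(π_F^{n(ψ_F)} P_E^{−m}) ⊂ O_{F_v} ⟺ π_F^{n(ψ_F)} P_E^{−m}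
⊂ D_R(S) = 𝔇^{−1} = P_E^{−d} (the middle ⟺ because π_F^n P_E^{−m} is an O_E-ideal I, and Tr(I) ⊂ O_F
⟺ I ⊂ D_R(S) by (3) of §3: x ∈ I ⇒ xO_E ⊂ I) ⟺ e·n(ψ_F) − m ≥ −d». In Mathlib's AKLB setting
(`A = O_{F_v}`, `B = O_{E_v}`, `K = F_v`, `L = E_v`), for every `B`-submodule `I` of `L` (a fractional
ideal):
* `trace_map_le_one_iff_le_inv_differentIdeal` : `Tr_{L/K}(I) ⊆ A ⟺ I ⊆ 𝔇⁻¹`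
  (`Submodule.le_traceDual_iff_map_le_one`, `FractionalIdeal.coe_dual_one`, `coeIdeal_differentIdeal`);
* `trace_map_le_one_iff_forall_mul_mem` : when `𝔇 = (x)`, `Tr(I) ⊆ A ⟺ x · I ⊆ B`;
* `trace_span_singleton_le_one_iff` : for `I = y B`, `Tr(yB) ⊆ A ⟺ x y ∈ B`;
* `trace_span_singleton_le_one_iff_val` : on the valuation ring `B` of `v`, `⟺ v x · v y ≤ 1`;
* `trace_span_singleton_le_one_iff_exp` : with `v x = exp(−d)`, `v y = exp(−k)` (`k = e·n − m`),
  `⟺ 0 ≤ d + k` — «`m ≤ e·n + d`», the conductor formula of (A6) once `ψ_F∘Tr` trivial on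
  `P_E^{−m}` is read as `Tr(π_F^{n} P_E^{−m}) ⊆ O_{F_v}`.

Stays prose: the definition of the conductor `n(ψ)` of an additive character (the largest `m` with
`ψ` trivial on `P^{−m}`), and that `ψ_F` is trivial on a fractional ideal `J` of `F_v` iff
`J ⊆ P_F^{−n(ψ_F)}`; the identification of the objects with `O_{E_v}/O_{F_v}`.
-/

namespace Summit.Ventures.HodgeRepro2.T5TraceDualConductor

open Module Algebra
open scoped nonZeroDivisors WithZero

section AKLB

variable (A K L B : Type*) [CommRing A] [Field K] [CommRing B] [Field L]
  [Algebra A K] [Algebra B L] [Algebra A B] [Algebra K L] [Algebra A L]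
  [IsScalarTower A K L] [IsScalarTower A B L]
  [IsDomain A] [IsFractionRing A K] [FiniteDimensional K L] [Algebra.IsSeparable K L]
  [IsIntegralClosure B A L] [IsIntegrallyClosed A] [IsDedekindDomain B]
  [Module.IsTorsionFree A B] [IsFractionRing B L]

/-- «`Tr(I) ⊆ O_F ⟺ I ⊆ 𝔇⁻¹`»: for a `B`-submodule `I` of `L`, the trace of `I` lies in `A`
iff `I` is contained in the inverse different. -/
theorem trace_map_le_one_iff_le_inv_differentIdeal (I : Submodule B L) :
    (I.restrictScalars A).map ((Algebra.trace K L).restrictScalars A) ≤ 1 ↔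
      I ≤ ((((differentIdeal A B : Ideal B) : FractionalIdeal B⁰ L)⁻¹ : FractionalIdeal B⁰ L) :
        Submodule B L) := by
  have h := coeIdeal_differentIdeal A K L B
  have h' : FractionalIdeal.dual A K (1 : FractionalIdeal B⁰ L) =
      (differentIdeal A B : FractionalIdeal B⁰ L)⁻¹ := by rw [h, inv_inv]
  rw [← h', FractionalIdeal.coe_dual_one, Submodule.le_traceDual_iff_map_le_one, mul_one]

/-- When `𝔇 = (x)`, `x ≠ 0`: `Tr(I) ⊆ A ⟺ x · I ⊆ B`. -/
theorem trace_map_le_one_iff_forall_mul_mem (x : B) (hx : differentIdeal A B = Ideal.span {x})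
    (hx0 : x ≠ 0) (I : Submodule B L) :
    (I.restrictScalars A).map ((Algebra.trace K L).restrictScalars A) ≤ 1 ↔
      ∀ y ∈ I, algebraMap B L x * y ∈ Set.range (algebraMap B L) := by
  have hx0' : algebraMap B L x ≠ 0 := fun h0 =>
    hx0 ((IsFractionRing.to_map_eq_zero_iff (K := L)).1 h0)
  rw [trace_map_le_one_iff_le_inv_differentIdeal A K L B I, hx,
    FractionalIdeal.coeIdeal_span_singleton, FractionalIdeal.spanSingleton_inv,
    FractionalIdeal.coe_spanSingleton, SetLike.le_def]
  refine forall₂_congr fun y _ => ?_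
  rw [Submodule.mem_span_singleton]
  constructor
  · rintro ⟨c, rfl⟩
    refine ⟨c, ?_⟩
    rw [Algebra.smul_def]
    calc algebraMap B L c = algebraMap B L c * (algebraMap B L x * (algebraMap B L x)⁻¹) := by
          rw [mul_inv_cancel₀ hx0', mul_one]
      _ = algebraMap B L x * (algebraMap B L c * (algebraMap B L x)⁻¹) := by ring
  · rintro ⟨c, hc⟩
    refine ⟨c, ?_⟩
    rw [Algebra.smul_def, hc]
    calc algebraMap B L x * y * (algebraMap B L x)⁻¹
        = y * (algebraMap B L x * (algebraMap B L x)⁻¹) := by ring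
      _ = y := by rw [mul_inv_cancel₀ hx0', mul_one]

/-- For the principal fractional ideal `I = y B`: `Tr(yB) ⊆ A ⟺ x y ∈ B`. -/
theorem trace_span_singleton_le_one_iff (x : B) (hx : differentIdeal A B = Ideal.span {x})
    (hx0 : x ≠ 0) (y : L) :
    ((Submodule.span B {y}).restrictScalars A).map ((Algebra.trace K L).restrictScalars A) ≤ 1 ↔
      algebraMap B L x * y ∈ Set.range (algebraMap B L) := by
  rw [trace_map_le_one_iff_forall_mul_mem A K L B x hx hx0]
  constructor
  · intro h
    exact h y (Submodule.mem_span_singleton_self y)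
  · rintro ⟨c, hc⟩ z hz
    obtain ⟨b, rfl⟩ := Submodule.mem_span_singleton.1 hz
    refine ⟨b * c, ?_⟩
    rw [map_mul, hc, Algebra.smul_def]
    ring

/-- In valuation form — `B` the valuation ring of `v : Valuation L Γ₀` (`Valuation.Integers v B`):
`Tr(yB) ⊆ A ⟺ v x · v y ≤ 1`; with `v x = v(π_E)^d`, `v y = v(π_F)^n v(π_E)^{−m}`,
`v(π_F) = v(π_E)^e` this is «`m ≤ e·n + d`», the conductor formula of (A6). -/
theorem trace_span_singleton_le_one_iff_val {Γ₀ : Type*} [LinearOrderedCommGroupWithZero Γ₀]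
    (v : Valuation L Γ₀) (hv : v.Integers B) (x : B) (hx : differentIdeal A B = Ideal.span {x})
    (hx0 : x ≠ 0) (y : L) :
    ((Submodule.span B {y}).restrictScalars A).map ((Algebra.trace K L).restrictScalars A) ≤ 1 ↔
      v (algebraMap B L x) * v y ≤ 1 := by
  rw [trace_span_singleton_le_one_iff A K L B x hx hx0, ← map_mul]
  constructor
  · rintro ⟨c, hc⟩
    rw [← hc]
    exact hv.map_le_one c
  · intro h
    obtain ⟨c, hc⟩ := hv.exists_of_le_one h
    exact ⟨c, hc⟩

/-- The exponent form of (A6): with `v(x) = exp(−d)` (`𝔇 = P_E^d`) and `v(y) = exp(−k)`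
(`y = π_F^n π_E^{−m}`, `k = e·n − m`), `Tr(yB) ⊆ A ⟺ 0 ≤ d + k`, i.e. «`m ≤ e·n + d`». -/
theorem trace_span_singleton_le_one_iff_exp (v : Valuation L ℤᵐ⁰) (hv : v.Integers B) (x : B)
    (hx : differentIdeal A B = Ideal.span {x}) (hx0 : x ≠ 0) (d : ℤ)
    (hxd : v (algebraMap B L x) = WithZero.exp (-d)) (y : L) (k : ℤ)
    (hy : v y = WithZero.exp (-k)) :
    ((Submodule.span B {y}).restrictScalars A).map ((Algebra.trace K L).restrictScalars A) ≤ 1 ↔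
      0 ≤ d + k := by
  rw [trace_span_singleton_le_one_iff_val A K L B v hv x hx hx0 y, hxd, hy, ← WithZero.exp_add,
    ← WithZero.exp_zero, WithZero.exp_le_exp]
  constructor <;> intro h <;> linarith

end AKLB

end Summit.Ventures.HodgeRepro2.T5TraceDualConductor
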